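import Literature.NumberTheory.Sieve.SieveFrameworkFundamentalLemma
import Literature.NumberTheory.Sieve.AsymptoticSieveForPrimesInputs
import HarnessLib

/-!
# Asymptotic sieve for primes: Brun's upper-bound sieve weights (proof)

Trunk T-SIEVE. This file DISCHARGES the named fact `Literature.NumberTheory.Sieve.brun_upperSieveWeights`
(`Literature.NumberTheory.Sieve.AsymptoticSieveForPrimesInputs`), the sieve input of
Friedlander–Iwaniec, *Asymptotic sieve for primes*, Ann. of Math. 148 (1998)
[FriedlanderIwaniecASP1998] §3 p. 1051 ("an upper-bound sieve `{λ_ν, ν ≤ Δ}` of level `Δ` …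
having the property `ρ_n = ∑_{ν ∣ n} λ_ν ≥ 0`") and §6 p. 1056 ("the sieve theory applies giving
`∑_ν λ_ν g(ν)h(ν) ≪ ∏_{p<Δ} (1 - g(p)h(p))`"), stated in the tree after Cojocaru–Murty,
*An Introduction to Sieve Methods and their Applications* (2005), Thm 6.2.5 (Brun's sieve) with the
hypotheses (2) `0 ≤ w(p) ≤ 1 - 1/A₁` and (3) `∑_{u ≤ p < v} w(p) log p ≤ κ log(v/u) + A₂`
[CojocaruMurty2005].

The proof is NOT Cojocaru–Murty's (Brun's `g_U`-truncation (6.11)) but the beta-sieve of the tree,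
`Literature.NumberTheory.Sieve.SieveFrameworkFundamentalLemma` (Greaves, *Sieves in Number Theory*
(2001), §3.3 [Greaves2001]; Friedlander–Iwaniec, *Opera de Cribro*, §6.5), which proves exactly the
two properties the fact asks for, for Rosser's upper truncation set `𝒟⁺` of level `D = z^β`,
`β = 9κ' + 1`:
* `BetaSieve.upper_sieve`: `0 ≤ [n = 1] ≤ ∑_{d ∣ n} μ(d) χ⁺(d)` (`n` squarefree), whence
  `ρ_n = ∑_{d ∣ (n, P(z))} μ(d)χ⁺(d) ≥ 0` for the weights `λ_d = μ(d)χ⁺(d) 1_{d ∣ P(z)}`;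
  `BetaSieve.lt_level_of_pred`: `χ⁺(d) = 1`, `d ∣ P(z)` imply `d < D`;
* `BetaSieve.abs_mainTerm_sub_le` and `BetaSieve.bdry_sum_le` (Greaves Lemma 3.1.4 and
  Lemma 3.3.6 with `b = 9`): for a multiplicative `g` of sieve dimension `κ'` (constant `K'`,
  `HasSieveDimension`) and `s = log D / log z ≥ β`,
  `∑_{d ∣ P(z)} μ(d)χ⁺(d) g(d) ≤ V(z) (1 + 2K'^{10} e^{β - s})`, `V(z) = ∏_{p<z} (1 - g(p))`.

What this file adds is the passage from Cojocaru–Murty's hypotheses (2)–(3) on a density `w`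
(given only on the primes `p < z`) to a sieve dimension for the multiplicative extension `g` of `w`
truncated at `z` (`BrunWeights.hasSieveDimension_trunc`): on a block `u ≤ p < v ≤ u²`,
`∑ w(p) ≤ (κ log(v/u) + A₂)/log u ≤ κ₁ = κ + A₂⁺/log 2` (`sum_block_le`); `[u, v)` is covered by
`I ≤ log₂(log v/log u) + 1` such blocks (`sum_le_mul_blocks`, `exists_blocks`); and
`(1 - w(p))⁻¹ ≤ e^{A₁ w(p)}` (`inv_one_sub_le_exp`), so that
`∏_{u ≤ p < v} (1 - w(p))⁻¹ ≤ e^{A₁κ₁} (log v/log u)^{A₁κ₁/log 2}` (`prod_inv_le_dim`): dimension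
`κ' = A₁κ₁/log 2`, constant `K' = e^{A₁κ₁}`. With `c = β = 9κ' + 1` and `C = 1 + 2K'^{10}`
(depending on `κ, A₁, A₂` only) this gives `brun_upperSieveWeights_holds`.

## Faithfulness notes

* The fact is proved as stated; the weights produced are the beta-sieve weights rather than Brun's
  (both are "`μ(d)` restricted to certain `d ≤ Δ` including `d = 1`", which is all FI p. 1051 ask).
  The dimension `κ'` is inflated (`A₁κ₁/log 2` instead of `κ`), immaterial for an upper bound with
  an unspecified constant `C(κ, A₁, A₂)`.
* Partial summation would give `∑_{u ≤ p < v} w(p) ≤ κ log(log v/log u) + A₂/log u`, i.e. dimension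
  `A₁κ`; the dyadic-block count used here is cruder but shorter.

## Mathlib search

Used: `ArithmeticFunction.prodPrimeFactors` (`prodPrimeFactors_apply`,
`IsMultiplicative.prodPrimeFactors`), `Nat.Prime.primeFactors`, `Finset.prod_filter_of_ne`,
`Finset.sum_filter_add_sum_filter_not`, `Real.add_one_le_exp`, `Real.exp_sum`,
`Real.rpow_def_of_pos`, `Nat.ceil_lt_add_one`, `Nat.lt_ceil`. The tree: `BetaSieve.{pred, ind,
pred_one, ind_of_pred, ind_of_not_pred, upper_sieve, lt_level_of_pred, abs_mainTerm_sub_le,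
bdry_sum_le, vprod, vlt_nonneg, map_eq_prod_primeFactors, prime_lt_of_mem_primeFactors_of_dvd}`,
`primeFactors_primesProdBelow`, `squarefree_primesProdBelow`, `HasSieveDimension`
(`…SieveFramework`, `…SieveFrameworkFundamentalLemma`). No other weight-form upper-bound sieve is in
the tree (`lean search 'IsUpperSieveWeights|upperSieveWeights'`: only `…Inputs` and its users);
Mathlib's `SelbergSieve` gives `Λ²`-weights, which are not of the combinatorial form
`λ_d ∈ {μ(d), 0}` required by `IsUpperSieveWeights`.
-/

noncomputable section

open Finset
open scoped ArithmeticFunction.Moebius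

namespace Literature.NumberTheory.Sieve

namespace BrunWeights

/-! ### From the one-sided logarithmic condition to a sieve dimension -/

variable {w : ℕ → ℝ} {z A₁ A₂ κ : ℝ}

/-- Membership in the prime ranges `u ≤ p < v` used by `HasSieveDimension`. [folklore] -/
theorem mem_primesRange_iff {u v : ℝ} {p : ℕ} :
    p ∈ (Nat.primesBelow ⌈v⌉₊).filter (fun p : ℕ => u ≤ (p : ℝ)) ↔
      p.Prime ∧ u ≤ (p : ℝ) ∧ (p : ℝ) < v := by
  rw [Finset.mem_filter, Nat.mem_primesBelow, Nat.lt_ceil]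
  tauto

/-- **One block** `u ≤ p < v ≤ u²`: `∑ w(p) ≤ (κ log(v/u) + A₂)/log u ≤ κ + A₂⁺/log 2`.
[cite: CojocaruMurty2005, proof of Thm 6.2.5] -/
theorem sum_block_le
    (h1 : ∀ p : ℕ, p.Prime → (p : ℝ) < z → 0 ≤ w p ∧ w p ≤ 1 - 1 / A₁)
    (h2 : ∀ u v : ℝ, 2 ≤ u → u ≤ v → v ≤ z →
      ∑ p ∈ (Nat.primesBelow ⌈v⌉₊).filter (fun p : ℕ => u ≤ (p : ℝ)), w p * Real.log p ≤
        κ * Real.log (v / u) + A₂)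
    (hκ : 0 ≤ κ) {u v : ℝ} (hu : 2 ≤ u) (huv : u ≤ v) (hvz : v ≤ z) (hvu : v ≤ u ^ 2) :
    ∑ p ∈ (Nat.primesBelow ⌈v⌉₊).filter (fun p : ℕ => u ≤ (p : ℝ)), w p ≤
      κ + max A₂ 0 / Real.log 2 := by
  have hu0 : 0 < u := by linarith
  have hlogu : Real.log 2 ≤ Real.log u := Real.log_le_log two_pos hu
  have hl2 : 0 < Real.log 2 := Real.log_pos one_lt_two
  have hlogu0 : 0 < Real.log u := hl2.trans_le hlogu
  -- `w(p) ≤ w(p) log p / log u` on the block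
  have hle : ∑ p ∈ (Nat.primesBelow ⌈v⌉₊).filter (fun p : ℕ => u ≤ (p : ℝ)), w p ≤
      (∑ p ∈ (Nat.primesBelow ⌈v⌉₊).filter (fun p : ℕ => u ≤ (p : ℝ)), w p * Real.log p) /
        Real.log u := by
    rw [le_div_iff₀ hlogu0, Finset.sum_mul]
    refine Finset.sum_le_sum fun p hp => ?_
    obtain ⟨hpp, hup, hpv⟩ := mem_primesRange_iff.mp hp
    have hw0 : 0 ≤ w p := (h1 p hpp (hpv.trans_le hvz)).1
    exact mul_le_mul_of_nonneg_left (Real.log_le_log hu0 hup) hw0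
  refine hle.trans ?_
  rw [div_le_iff₀ hlogu0]
  refine (h2 u v hu huv hvz).trans ?_
  have hvu' : Real.log (v / u) ≤ Real.log u := by
    rw [Real.log_div (by linarith) hu0.ne', sub_le_iff_le_add, ← two_mul]
    have : Real.log v ≤ Real.log (u ^ 2) := Real.log_le_log (by linarith) hvu
    rwa [Real.log_pow, Nat.cast_ofNat] at this
  have hA : A₂ ≤ max A₂ 0 / Real.log 2 * Real.log u := by
    calc A₂ ≤ max A₂ 0 := le_max_left _ _
      _ = max A₂ 0 / Real.log 2 * Real.log 2 := by field_simp
      _ ≤ max A₂ 0 / Real.log 2 * Real.log u :=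
          mul_le_mul_of_nonneg_left hlogu (div_nonneg (le_max_right _ _) hl2.le)
  calc κ * Real.log (v / u) + A₂ ≤ κ * Real.log u + max A₂ 0 / Real.log 2 * Real.log u :=
        add_le_add (mul_le_mul_of_nonneg_left hvu' hκ) hA
    _ = (κ + max A₂ 0 / Real.log 2) * Real.log u := by ring

/-- **`I` blocks**: for `2 ≤ u ≤ v ≤ z` with `v ≤ u^{2^I}`, `∑_{u ≤ p < v} w(p) ≤ I (κ + A₂⁺/log 2)`
(induction on `I`, splitting at `u²`). [cite: CojocaruMurty2005, proof of Thm 6.2.5] -/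
theorem sum_le_mul_blocks
    (h1 : ∀ p : ℕ, p.Prime → (p : ℝ) < z → 0 ≤ w p ∧ w p ≤ 1 - 1 / A₁)
    (h2 : ∀ u v : ℝ, 2 ≤ u → u ≤ v → v ≤ z →
      ∑ p ∈ (Nat.primesBelow ⌈v⌉₊).filter (fun p : ℕ => u ≤ (p : ℝ)), w p * Real.log p ≤
        κ * Real.log (v / u) + A₂)
    (hκ : 0 ≤ κ) (I : ℕ) :
    ∀ {u v : ℝ}, 2 ≤ u → u ≤ v → v ≤ z → v ≤ u ^ (2 ^ I) →
      ∑ p ∈ (Nat.primesBelow ⌈v⌉₊).filter (fun p : ℕ => u ≤ (p : ℝ)), w p ≤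
        I * (κ + max A₂ 0 / Real.log 2) := by
  have hκ₁ : 0 ≤ κ + max A₂ 0 / Real.log 2 :=
    add_nonneg hκ (div_nonneg (le_max_right _ _) (Real.log_pos one_lt_two).le)
  induction I with
  | zero =>
    intro u v hu huv hvz hvI
    rw [pow_zero, pow_one] at hvI
    rw [Nat.cast_zero, zero_mul]
    refine (Finset.sum_eq_zero fun p hp => ?_).le
    obtain ⟨-, hup, hpv⟩ := mem_primesRange_iff.mp hp
    linarith
  | succ I ih =>
    intro u v hu huv hvz hvI
    have hu0 : 0 < u := by linarith
    -- nonnegativity of the summands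
    have hw0 : ∀ p ∈ (Nat.primesBelow ⌈v⌉₊).filter (fun p : ℕ => u ≤ (p : ℝ)), 0 ≤ w p := by
      intro p hp
      obtain ⟨hpp, -, hpv⟩ := mem_primesRange_iff.mp hp
      exact (h1 p hpp (hpv.trans_le hvz)).1
    rcases le_or_gt v (u ^ 2) with hv2 | hv2
    · -- a single block
      calc ∑ p ∈ (Nat.primesBelow ⌈v⌉₊).filter (fun p : ℕ => u ≤ (p : ℝ)), w p
          ≤ κ + max A₂ 0 / Real.log 2 := sum_block_le h1 h2 hκ hu huv hvz hv2
        _ = 1 * (κ + max A₂ 0 / Real.log 2) := (one_mul _).symm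
        _ ≤ (I + 1 : ℕ) * (κ + max A₂ 0 / Real.log 2) := by
            refine mul_le_mul_of_nonneg_right ?_ hκ₁
            exact_mod_cast Nat.le_add_left 1 I
    · -- split at `u²`
      have hu2 : 2 ≤ u ^ 2 := by nlinarith
      have hsplit := (Finset.sum_filter_add_sum_filter_not
        ((Nat.primesBelow ⌈v⌉₊).filter (fun p : ℕ => u ≤ (p : ℝ))) (fun p : ℕ => (p : ℝ) < u ^ 2)
        w).symm
      rw [hsplit]
      have hA : ∑ p ∈ ((Nat.primesBelow ⌈v⌉₊).filter (fun p : ℕ => u ≤ (p : ℝ))).filter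
            (fun p : ℕ => (p : ℝ) < u ^ 2), w p ≤ κ + max A₂ 0 / Real.log 2 := by
        refine le_trans (Finset.sum_le_sum_of_subset_of_nonneg ?_ ?_)
          (sum_block_le h1 h2 hκ hu (by nlinarith) (hv2.le.trans hvz) le_rfl)
        · intro p hp
          obtain ⟨hp1, hp2⟩ := Finset.mem_filter.mp hp
          obtain ⟨hpp, hup, -⟩ := mem_primesRange_iff.mp hp1
          exact mem_primesRange_iff.mpr ⟨hpp, hup, hp2⟩
        · intro p hp _
          obtain ⟨hpp, -, hpv⟩ := mem_primesRange_iff.mp hp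
          exact (h1 p hpp (hpv.trans_le (hv2.le.trans hvz))).1
      have hB : ∑ p ∈ ((Nat.primesBelow ⌈v⌉₊).filter (fun p : ℕ => u ≤ (p : ℝ))).filter
            (fun p : ℕ => ¬(p : ℝ) < u ^ 2), w p ≤ I * (κ + max A₂ 0 / Real.log 2) := by
        refine le_trans (Finset.sum_le_sum_of_subset_of_nonneg ?_ ?_)
          (ih hu2 hv2.le hvz (by rw [← pow_mul, ← pow_succ']; exact hvI))
        · intro p hp
          obtain ⟨hp1, hp2⟩ := Finset.mem_filter.mp hp
          obtain ⟨hpp, -, hpv⟩ := mem_primesRange_iff.mp hp1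
          exact mem_primesRange_iff.mpr ⟨hpp, not_lt.mp hp2, hpv⟩
        · intro p hp _
          obtain ⟨hpp, -, hpv⟩ := mem_primesRange_iff.mp hp
          exact (h1 p hpp (hpv.trans_le hvz)).1
      calc _ ≤ (κ + max A₂ 0 / Real.log 2) + I * (κ + max A₂ 0 / Real.log 2) := add_le_add hA hB
        _ = (I + 1 : ℕ) * (κ + max A₂ 0 / Real.log 2) := by push_cast; ring

/-- The number of blocks: for `2 ≤ u ≤ v` there is `I` with `v ≤ u^{2^I}` and
`I ≤ log₂(log v / log u) + 1`. [folklore] -/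
theorem exists_blocks {u v : ℝ} (hu : 2 ≤ u) (huv : u ≤ v) :
    ∃ I : ℕ, v ≤ u ^ (2 ^ I) ∧
      (I : ℝ) ≤ Real.log (Real.log v / Real.log u) / Real.log 2 + 1 := by
  have hu0 : 0 < u := by linarith
  have hu1 : 1 < u := by linarith
  have hlogu : 0 < Real.log u := Real.log_pos hu1
  have hlogv : 0 < Real.log v := Real.log_pos (hu1.trans_le huv)
  set r := Real.log v / Real.log u with hr
  have hr1 : 1 ≤ r := by rw [hr, le_div_iff₀ hlogu, one_mul]; exact Real.log_le_log hu0 huv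
  have hr0 : 0 < r := one_pos.trans_le hr1
  set L := Real.log r / Real.log 2 with hL
  have hL0 : 0 ≤ L := div_nonneg (Real.log_nonneg hr1) (Real.log_pos one_lt_two).le
  refine ⟨⌈L⌉₊, ?_, ?_⟩
  · -- `v = u^r ≤ u^{2^I}` since `r ≤ 2^I`
    have h2I : r ≤ (2 : ℝ) ^ (⌈L⌉₊ : ℕ) := by
      have hlog : Real.log r ≤ (⌈L⌉₊ : ℕ) * Real.log 2 := by
        have := Nat.le_ceil L
        rw [hL, div_le_iff₀ (Real.log_pos one_lt_two)] at this
        exact this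
      rw [← Real.log_le_log_iff hr0 (by positivity), Real.log_pow]
      exact hlog
    have hv : v = u ^ r := by
      rw [Real.rpow_def_of_pos hu0, hr, mul_div_cancel₀ _ hlogu.ne', Real.exp_log (by linarith)]
    rw [hv, ← Real.rpow_natCast]
    exact Real.rpow_le_rpow_of_exponent_le hu1.le (by exact_mod_cast h2I)
  · exact (Nat.ceil_lt_add_one hL0).le

/-- `(1 - t)⁻¹ ≤ exp(A₁ t)` for `0 ≤ t ≤ 1 - 1/A₁`, `A₁ ≥ 1`. [folklore] -/
theorem inv_one_sub_le_exp (hA₁ : 1 ≤ A₁) {t : ℝ} (ht0 : 0 ≤ t) (ht1 : t ≤ 1 - 1 / A₁) :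
    (1 - t)⁻¹ ≤ Real.exp (A₁ * t) := by
  have hA0 : 0 < A₁ := by linarith
  have h1t : 1 / A₁ ≤ 1 - t := by linarith
  have h1t0 : 0 < 1 - t := lt_of_lt_of_le (by positivity) h1t
  refine le_trans ?_ (Real.add_one_le_exp (A₁ * t))
  rw [inv_le_iff_one_le_mul₀ h1t0]
  -- `1 ≤ (A₁ t + 1)(1 - t)` iff `0 ≤ t (A₁ (1 - t) - 1)`
  have hA1t : 1 ≤ A₁ * (1 - t) := by
    calc (1 : ℝ) = A₁ * (1 / A₁) := by field_simp
      _ ≤ A₁ * (1 - t) := mul_le_mul_of_nonneg_left h1t hA0.le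
  nlinarith

/-- **The product bound**: `∏_{u ≤ p < v} (1 - w(p))⁻¹ ≤ exp(A₁ ∑_{u ≤ p < v} w(p))` for `v ≤ z`.
[folklore] -/
theorem prod_inv_le_exp (hA₁ : 1 ≤ A₁)
    (h1 : ∀ p : ℕ, p.Prime → (p : ℝ) < z → 0 ≤ w p ∧ w p ≤ 1 - 1 / A₁) {u v : ℝ} (hvz : v ≤ z) :
    ∏ p ∈ (Nat.primesBelow ⌈v⌉₊).filter (fun p : ℕ => u ≤ (p : ℝ)), (1 - w p)⁻¹ ≤
      Real.exp (A₁ * ∑ p ∈ (Nat.primesBelow ⌈v⌉₊).filter (fun p : ℕ => u ≤ (p : ℝ)), w p) := by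
  rw [Finset.mul_sum, Real.exp_sum]
  refine Finset.prod_le_prod (fun p hp => ?_) fun p hp => ?_
  · obtain ⟨hpp, -, hpv⟩ := mem_primesRange_iff.mp hp
    have := (h1 p hpp (hpv.trans_le hvz))
    have hA0 : 0 < A₁ := by linarith
    exact inv_nonneg.mpr (by linarith [one_div_pos.mpr hA0] : 0 ≤ 1 - w p)
  · obtain ⟨hpp, -, hpv⟩ := mem_primesRange_iff.mp hp
    have := h1 p hpp (hpv.trans_le hvz)
    exact inv_one_sub_le_exp hA₁ this.1 this.2

/-- **Sieve dimension from the logarithmic condition** (Cojocaru–Murty Thm 6.2.5, hypotheses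
(2)–(3) ⇒ Halberstam–Richert `Ω₂(κ')`): if `0 ≤ w(p) ≤ 1 - 1/A₁` for `p < z` and
`∑_{u ≤ p < v} w(p) log p ≤ κ log(v/u) + A₂` for `2 ≤ u ≤ v ≤ z`, then for `2 ≤ u ≤ v ≤ z`,
`∏_{u ≤ p < v} (1 - w(p))⁻¹ ≤ K' (log v / log u)^{κ'}` with `κ₁ = κ + A₂⁺/log 2`,
`κ' = A₁κ₁/log 2`, `K' = e^{A₁κ₁}`. [cite: CojocaruMurty2005, proof of Thm 6.2.5] -/
theorem prod_inv_le_dim (hA₁ : 1 ≤ A₁)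
    (h1 : ∀ p : ℕ, p.Prime → (p : ℝ) < z → 0 ≤ w p ∧ w p ≤ 1 - 1 / A₁)
    (h2 : ∀ u v : ℝ, 2 ≤ u → u ≤ v → v ≤ z →
      ∑ p ∈ (Nat.primesBelow ⌈v⌉₊).filter (fun p : ℕ => u ≤ (p : ℝ)), w p * Real.log p ≤
        κ * Real.log (v / u) + A₂)
    (hκ : 0 ≤ κ) {u v : ℝ} (hu : 2 ≤ u) (huv : u ≤ v) (hvz : v ≤ z) :
    ∏ p ∈ (Nat.primesBelow ⌈v⌉₊).filter (fun p : ℕ => u ≤ (p : ℝ)), (1 - w p)⁻¹ ≤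
      Real.exp (A₁ * (κ + max A₂ 0 / Real.log 2)) *
        (Real.log v / Real.log u) ^ (A₁ * (κ + max A₂ 0 / Real.log 2) / Real.log 2) := by
  set κ₁ := κ + max A₂ 0 / Real.log 2 with hκ₁def
  have hl2 : 0 < Real.log 2 := Real.log_pos one_lt_two
  have hκ₁ : 0 ≤ κ₁ := add_nonneg hκ (div_nonneg (le_max_right _ _) hl2.le)
  have hA0 : 0 ≤ A₁ := by linarith
  obtain ⟨I, hvI, hI⟩ := exists_blocks hu huv
  have hS := sum_le_mul_blocks h1 h2 hκ I hu huv hvz hvI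
  refine (prod_inv_le_exp hA₁ h1 hvz).trans ?_
  have hu1 : 1 < u := by linarith
  have hlogu : 0 < Real.log u := Real.log_pos hu1
  have hr0 : 0 < Real.log v / Real.log u :=
    div_pos (Real.log_pos (hu1.trans_le huv)) hlogu
  rw [Real.rpow_def_of_pos hr0, ← Real.exp_add]
  refine Real.exp_le_exp.mpr ?_
  calc A₁ * ∑ p ∈ (Nat.primesBelow ⌈v⌉₊).filter (fun p : ℕ => u ≤ (p : ℝ)), w p
      ≤ A₁ * (I * κ₁) := mul_le_mul_of_nonneg_left hS hA0
    _ ≤ A₁ * ((Real.log (Real.log v / Real.log u) / Real.log 2 + 1) * κ₁) :=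
        mul_le_mul_of_nonneg_left (mul_le_mul_of_nonneg_right hI hκ₁) hA0
    _ = A₁ * κ₁ + Real.log (Real.log v / Real.log u) * (A₁ * κ₁ / Real.log 2) := by
        field_simp
        ring


/-! ### The truncated density and its dimension -/

/-- The dimension bound of `prod_inv_le_dim` for the multiplicative extension `g` of `w` truncated
at `z` (`g(p) = w(p)` for `p < z`, `g(p) = 0` for `p ≥ z`), in the form `HasSieveDimension`.
[cite: CojocaruMurty2005, proof of Thm 6.2.5] -/
theorem hasSieveDimension_trunc (hA₁ : 1 ≤ A₁) (hz : 2 ≤ z)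
    (h1 : ∀ p : ℕ, p.Prime → (p : ℝ) < z → 0 ≤ w p ∧ w p ≤ 1 - 1 / A₁)
    (h2 : ∀ u v : ℝ, 2 ≤ u → u ≤ v → v ≤ z →
      ∑ p ∈ (Nat.primesBelow ⌈v⌉₊).filter (fun p : ℕ => u ≤ (p : ℝ)), w p * Real.log p ≤
        κ * Real.log (v / u) + A₂)
    (hκ : 0 ≤ κ) :
    HasSieveDimension
      (ArithmeticFunction.prodPrimeFactors (fun p : ℕ => if (p : ℝ) < z then w p else 0))
      (A₁ * (κ + max A₂ 0 / Real.log 2) / Real.log 2)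
      (Real.exp (A₁ * (κ + max A₂ 0 / Real.log 2))) := by
  set f : ℕ → ℝ := fun p => if (p : ℝ) < z then w p else 0 with hf
  set κ' := A₁ * (κ + max A₂ 0 / Real.log 2) / Real.log 2 with hκ'
  set K' := Real.exp (A₁ * (κ + max A₂ 0 / Real.log 2)) with hK'
  have hl2 : 0 < Real.log 2 := Real.log_pos one_lt_two
  have hA0 : 0 < A₁ := by linarith
  have hκ₁ : 0 ≤ κ + max A₂ 0 / Real.log 2 := add_nonneg hκ (div_nonneg (le_max_right _ _) hl2.le)
  have hκ'0 : 0 ≤ κ' := div_nonneg (mul_nonneg hA0.le hκ₁) hl2.le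
  have hK'1 : 1 ≤ K' := Real.one_le_exp (mul_nonneg hA0.le hκ₁)
  have hgp : ∀ p : ℕ, p.Prime → ArithmeticFunction.prodPrimeFactors f p = f p := fun p hp => by
    rw [ArithmeticFunction.prodPrimeFactors_apply hp.ne_zero, hp.primeFactors,
      Finset.prod_singleton]
  refine ⟨fun p hp => ?_, fun u v hu huv => ?_⟩
  · rw [hgp p hp]
    simp only [hf]
    split_ifs with hpz
    · have := h1 p hp hpz
      exact ⟨this.1, lt_of_le_of_lt this.2 (by linarith [one_div_pos.mpr hA0])⟩
    · exact ⟨le_rfl, zero_lt_one⟩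
  · -- remove the primes `≥ z` (where `g = 0`) and compare with `prod_inv_le_dim`
    have hu1 : 1 < u := by linarith
    have hlogu : 0 < Real.log u := Real.log_pos hu1
    have hratio : 1 ≤ Real.log v / Real.log u := by
      rw [le_div_iff₀ hlogu, one_mul]; exact Real.log_le_log (by linarith) huv
    set S := (Nat.primesBelow ⌈v⌉₊).filter (fun p : ℕ => u ≤ (p : ℝ)) with hS
    have hprod : ∏ p ∈ S, (1 - ArithmeticFunction.prodPrimeFactors f p)⁻¹ =
        ∏ p ∈ S.filter (fun p : ℕ => (p : ℝ) < z), (1 - w p)⁻¹ := by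
      rw [← Finset.prod_filter_of_ne (p := fun p : ℕ => (p : ℝ) < z) (fun p hp hne => ?_)]
      · refine Finset.prod_congr rfl fun p hp => ?_
        obtain ⟨hp1, hp2⟩ := Finset.mem_filter.mp hp
        obtain ⟨hpp, -, -⟩ := mem_primesRange_iff.mp hp1
        rw [hgp p hpp]
        simp only [hf, if_pos hp2]
      · obtain ⟨hpp, -, -⟩ := mem_primesRange_iff.mp hp
        by_contra hpz
        rw [hgp p hpp] at hne
        simp only [hf, if_neg hpz, sub_zero, inv_one, ne_eq, not_true_eq_false] at hne
    rw [hprod]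
    rcases le_or_gt v z with hvz | hvz
    · -- `v ≤ z`: the filter is everything
      have hset : S.filter (fun p : ℕ => (p : ℝ) < z) = S := by
        refine Finset.filter_true_of_mem fun p hp => ?_
        obtain ⟨-, -, hpv⟩ := mem_primesRange_iff.mp hp
        exact hpv.trans_le hvz
      rw [hset]
      exact prod_inv_le_dim hA₁ h1 h2 hκ hu huv hvz
    · rcases le_or_gt u z with huz | huz
      · -- `u ≤ z < v`: the filter is the range `u ≤ p < z`
        have hset : S.filter (fun p : ℕ => (p : ℝ) < z) =
            (Nat.primesBelow ⌈z⌉₊).filter (fun p : ℕ => u ≤ (p : ℝ)) := by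
          ext p
          rw [Finset.mem_filter, mem_primesRange_iff, mem_primesRange_iff]
          constructor
          · rintro ⟨⟨hpp, hup, -⟩, hpz⟩; exact ⟨hpp, hup, hpz⟩
          · rintro ⟨hpp, hup, hpz⟩; exact ⟨⟨hpp, hup, hpz.trans hvz⟩, hpz⟩
        rw [hset]
        refine (prod_inv_le_dim hA₁ h1 h2 hκ hu huz le_rfl).trans ?_
        refine mul_le_mul_of_nonneg_left ?_ (zero_le_one.trans hK'1)
        refine Real.rpow_le_rpow (div_nonneg (Real.log_nonneg (hu1.le.trans huz)) hlogu.le) ?_ hκ'0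
        exact div_le_div_of_nonneg_right (Real.log_le_log (by linarith) hvz.le) hlogu.le
      · -- `z < u`: empty range
        have hset : S.filter (fun p : ℕ => (p : ℝ) < z) = ∅ := by
          refine Finset.filter_false_of_mem fun p hp => ?_
          obtain ⟨-, hup, -⟩ := mem_primesRange_iff.mp hp
          exact not_lt.mpr (huz.le.trans hup)
        rw [hset, Finset.prod_empty]
        calc (1 : ℝ) = 1 * 1 := (one_mul _).symm
          _ ≤ K' * (Real.log v / Real.log u) ^ κ' :=
              mul_le_mul hK'1 (Real.one_le_rpow hratio hκ'0) zero_le_one (by positivity)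

end BrunWeights

/-! ### Brun's upper-bound sieve weights -/

open BrunWeights in
/-- **Brun's upper-bound sieve in weight form** — the discharge of the named fact
`Literature.NumberTheory.Sieve.brun_upperSieveWeights` (`…AsymptoticSieveForPrimesInputs`) by the beta-sieve of the tree
(`Literature.NumberTheory.Sieve.SieveFrameworkFundamentalLemma`, Greaves §3.3 = Friedlander–Iwaniec,
*Opera de Cribro*, §6.5): given `κ > 0`, `A₁ ≥ 1`, `A₂`, put `κ₁ = κ + A₂⁺/log 2`,
`κ' = A₁κ₁/log 2`, `K' = e^{A₁κ₁}`, `c = β = 9κ' + 1`, `C = 1 + 2K'^{10}`; for `z ≥ 2` the weights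
are `λ_d = μ(d) χ⁺(d)` (`χ⁺` the indicator of Rosser's upper truncation set
`BetaSieve.pred 1 β z^β`) restricted to `d ∣ P(z)`. They are upper-bound sieve weights of level
`z^β` (`BetaSieve.upper_sieve`, `BetaSieve.lt_level_of_pred`), and for every density `w` satisfying
Cojocaru–Murty's (2)–(3) the multiplicative extension of `w` truncated at `z` has sieve dimension
`κ'` with constant `K'` (`hasSieveDimension_trunc`), so that the main-term identity and the
boundary-sum estimate of the beta-sieve (`BetaSieve.abs_mainTerm_sub_le`, `BetaSieve.bdry_sum_le`
with `s = β`) give `∑_{d ∣ P(z)} λ_d w(d) ≤ (1 + 2K'^{10}) ∏_{p<z} (1 - w(p))`.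
[cite: CojocaruMurty2005, Thm 6.2.3, (6.11), Lemma 6.2.4 and proof of Thm 6.2.5]
[cite: Greaves2001, §3.3.4 Thm 1] -/
theorem brun_upperSieveWeights_holds : brun_upperSieveWeights := by
  intro κ A₁ A₂ hκ hA₁
  set κ₁ := κ + max A₂ 0 / Real.log 2 with hκ₁
  set κ' := A₁ * κ₁ / Real.log 2 with hκ'
  set K' := Real.exp (A₁ * κ₁) with hK'
  set β := 9 * κ' + 1 with hβ
  have hl2 : 0 < Real.log 2 := Real.log_pos one_lt_two
  have hl2' : Real.log 2 < 1 := by have := Real.log_two_lt_d9; linarith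
  have hA0 : 0 < A₁ := by linarith
  have hκ₁0 : 0 < κ₁ :=
    lt_of_lt_of_le hκ (le_add_of_nonneg_right (div_nonneg (le_max_right _ _) hl2.le))
  have hκ'0 : 0 < κ' := div_pos (mul_pos hA0 hκ₁0) hl2
  have hβ1 : 1 < β := by rw [hβ]; linarith
  have hβ0 : 0 < β := by linarith
  have hK'0 : 0 < K' := Real.exp_pos _
  refine ⟨β, 1 + 2 * K' ^ (10 : ℕ), hβ0, by positivity, fun z hz => ?_⟩
  classical
  have hz0 : 0 < z := by linarith
  have hz1 : 1 < z := by linarith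
  set D := z ^ β with hD
  have hD1 : 1 < D := Real.one_lt_rpow hz1 hβ0
  have hzD : β * Real.log z ≤ Real.log D := by rw [hD, Real.log_rpow hz0]
  set P := primesProdBelow z with hP
  have hPsq : Squarefree P := squarefree_primesProdBelow z
  have hP0 : P ≠ 0 := hPsq.ne_zero
  -- the weights
  refine ⟨fun d => if d ∣ P ∧ BetaSieve.pred 1 β D d then μ d else 0, ?_, fun w hw1 hw2 => ?_⟩
  · refine ⟨?_, fun d => ?_, fun d hd => ?_, fun n hn => ?_⟩
    · rw [if_pos ⟨one_dvd _, BetaSieve.pred_one⟩, ArithmeticFunction.moebius_apply_one]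
    · by_cases h : d ∣ P ∧ BetaSieve.pred 1 β D d
      · exact Or.inl (if_pos h)
      · exact Or.inr (if_neg h)
    · by_cases h : d ∣ P ∧ BetaSieve.pred 1 β D d
      · exact ⟨h.1, (BetaSieve.lt_level_of_pred hβ1 hD1 hzD (hPsq.squarefree_of_dvd h.1)
          (fun p hp => BetaSieve.prime_lt_of_mem_primeFactors_of_dvd h.1 hp) h.2).le⟩
      · exact absurd (if_neg h) hd
    · -- `∑_{d ∣ n} λ_d = ∑_{d ∣ (n, P(z))} μ(d) χ⁺(d) ≥ 0`
      have hm0 : Nat.gcd n P ≠ 0 := Nat.gcd_ne_zero_right hP0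
      have hmsq : Squarefree (Nat.gcd n P) := hPsq.squarefree_of_dvd (Nat.gcd_dvd_right n P)
      have hset : n.divisors.filter (· ∣ P) = (Nat.gcd n P).divisors := by
        ext d
        simp only [Finset.mem_filter, Nat.mem_divisors, Nat.dvd_gcd_iff]
        constructor
        · rintro ⟨⟨hdn, -⟩, hdP⟩; exact ⟨⟨hdn, hdP⟩, hm0⟩
        · rintro ⟨⟨hdn, hdP⟩, -⟩; exact ⟨⟨hdn, hn⟩, hdP⟩
      have hsum : (∑ d ∈ n.divisors, (if d ∣ P ∧ BetaSieve.pred 1 β D d then μ d else 0) : ℤ) =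
          ∑ d ∈ (Nat.gcd n P).divisors, if BetaSieve.pred 1 β D d then μ d else 0 := by
        rw [← hset, Finset.sum_filter]
        refine Finset.sum_congr rfl fun d _ => ?_
        by_cases h1 : d ∣ P
        · simp only [h1, true_and, if_true]
        · simp only [h1, false_and, if_false]
      rw [hsum]
      have hreal : ((∑ d ∈ (Nat.gcd n P).divisors,
          (if BetaSieve.pred 1 β D d then μ d else 0) : ℤ) : ℝ) =
          ∑ d ∈ (Nat.gcd n P).divisors, (μ d : ℝ) * BetaSieve.ind 1 β D d := by
        push_cast
        refine Finset.sum_congr rfl fun d _ => ?_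
        by_cases h : BetaSieve.pred 1 β D d
        · rw [if_pos h, BetaSieve.ind_of_pred h, mul_one]
        · rw [if_neg h, BetaSieve.ind_of_not_pred h, mul_zero]
      have hus := BetaSieve.upper_sieve (β := β) (D := D) hmsq
      have h0 : (0 : ℝ) ≤ ∑ d ∈ (Nat.gcd n P).divisors, (μ d : ℝ) * BetaSieve.ind 1 β D d :=
        le_trans (by split_ifs <;> norm_num) hus
      rw [← hreal] at h0
      exact_mod_cast h0
  · -- the main-term bound for an admissible density `w`
    set g := ArithmeticFunction.prodPrimeFactors (fun p : ℕ => if (p : ℝ) < z then w p else 0)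
      with hg
    have hgm : g.IsMultiplicative := ArithmeticFunction.IsMultiplicative.prodPrimeFactors _
    have hgp : ∀ p : ℕ, p.Prime → g p = if (p : ℝ) < z then w p else 0 := fun p hp => by
      rw [hg, ArithmeticFunction.prodPrimeFactors_apply hp.ne_zero, hp.primeFactors,
        Finset.prod_singleton]
    have hdim : HasSieveDimension g κ' K' := hasSieveDimension_trunc hA₁ hz hw1 hw2 hκ.le
    -- `g(d) = ∏_{p ∣ d} w(p)` and `0 ≤ g ≤ 1` on the divisors of `P(z)`
    have hgd : ∀ d, d ∣ P → g d = ∏ p ∈ d.primeFactors, w p := by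
      intro d hd
      have hd0 : d ≠ 0 := (hPsq.squarefree_of_dvd hd).ne_zero
      rw [hg, ArithmeticFunction.prodPrimeFactors_apply hd0]
      refine Finset.prod_congr rfl fun p hp => ?_
      simp only [if_pos (BetaSieve.prime_lt_of_mem_primeFactors_of_dvd hd hp)]
    have h01 : ∀ p ∈ P.primeFactors, 0 ≤ g p ∧ g p ≤ 1 := fun p hp =>
      ⟨(hdim.1 p (Nat.prime_of_mem_primeFactors hp)).1,
        (hdim.1 p (Nat.prime_of_mem_primeFactors hp)).2.le⟩
    have hg0 : ∀ t ∈ P.divisors, 0 ≤ g t := by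
      intro t ht
      have htd : t ∣ P := Nat.dvd_of_mem_divisors ht
      rw [BetaSieve.map_eq_prod_primeFactors hgm (hPsq.squarefree_of_dvd htd)]
      exact Finset.prod_nonneg fun p hp => (h01 p (Nat.primeFactors_mono htd hP0 hp)).1
    -- the beta-sieve main-term estimate with `s = β`
    have hmain := BetaSieve.abs_mainTerm_sub_le (par := 1) (β := β) (D := D) hgm hPsq hg0
      (BetaSieve.vlt_nonneg h01)
    have hbd := BetaSieve.bdry_sum_le (par := 1) hgm hdim hκ'0 hz hD1 hβ hzD
    have hs : Real.exp (β - Real.log D / Real.log z) = 1 := by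
      rw [hD, Real.log_rpow hz0, mul_div_assoc, div_self (Real.log_pos hz1).ne', mul_one, sub_self,
        Real.exp_zero]
    rw [hs, mul_one] at hbd
    have hV : BetaSieve.vprod g P = ∏ p ∈ Nat.primesBelow ⌈z⌉₊, (1 - w p) := by
      rw [BetaSieve.vprod, hP, primeFactors_primesProdBelow]
      refine Finset.prod_congr rfl fun p hp => ?_
      have hpp := Nat.prime_of_mem_primesBelow hp
      have hpz : (p : ℝ) < z := Nat.lt_ceil.mp (Nat.mem_primesBelow.mp hp).1
      rw [hgp p hpp, if_pos hpz]
    -- rewrite the weighted sum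
    have hL : ∑ d ∈ P.divisors, ((if d ∣ P ∧ BetaSieve.pred 1 β D d then μ d else 0 : ℤ) : ℝ) *
        ∏ p ∈ d.primeFactors, w p =
        ∑ d ∈ P.divisors, (μ d : ℝ) * BetaSieve.ind 1 β D d * g d := by
      refine Finset.sum_congr rfl fun d hd => ?_
      have hdP : d ∣ P := Nat.dvd_of_mem_divisors hd
      rw [hgd d hdP]
      by_cases h : BetaSieve.pred 1 β D d
      · rw [if_pos ⟨hdP, h⟩, BetaSieve.ind_of_pred h, mul_one]
      · rw [if_neg (fun h' => h h'.2), BetaSieve.ind_of_not_pred h, mul_zero, Int.cast_zero]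
    rw [hL, ← hV]
    have habs := abs_sub_le_iff.mp (hmain.trans hbd)
    linarith [habs.1]

end Literature.NumberTheory.Sieve
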